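import Mathlib.Analysis.SpecialFunctions.Complex.Circle
import Mathlib.Data.ZMod.Basic
import Mathlib.Data.Nat.Log
import Mathlib.Algebra.BigOperators.Field
import Mathlib.Analysis.SpecialFunctions.Trigonometric.Bounds
import Mathlib.Analysis.MeanInequalitiesPow
import Mathlib.Data.Nat.Prime.Basic
import HarnessLib

/-!
# Barrier catalogue `QuantumAdvantage`: nonclassical polynomials of degree `O(log n)` defeat the
# derivative / Gowers-norm method for `MOD_m` correlation bounds (Bhowmick–Lovett 2015) — the
# printed form of the "degree-`log n` barrier"

D-0021 barrier entry for the summit `QuantumAdvantage`, bearing on the shallow-circuit sub-problem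
`AdviceFreeQNC0` (advice-free `QNC⁰ ⊄ AC⁰[p]`): the ceiling notes of the routes `OddPrimeWalk` /
`DWalkThree` (cell qa-qnc0, planner file ROUND-19 §6, 2026-08-28) list as method family (a)
"Smolensky-type degree bounds / exponential sums against `𝔽_p`-polynomials, known only up to degree
`O(log n)` — the degree-`log n` barrier".  In print this barrier is (i) folklore wording —
"Degree log(n) represents the fundamental limit of our current suite of powerful techniques for
proving `F₂` correlation bounds [BNS92, Bourgain05, Chattopadhyay07, VW08], and breaking this
'degree-log(n) barrier' would constitute a significant technical breakthrough" [ServedioTan2022, p. 8];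
"Achieving correlation less than `1/√n` for polynomials of degree `log n` remains open, for any
explicit function" [IvanovPavlovicViola2023, §1 p. 3] — and (ii) ONE THEOREM explaining it for the
derivative-based methods, which this file vendors and PROVES:

* A. Bhowmick, S. Lovett, *Nonclassical polynomials as a barrier to polynomial lower bounds*,
  CCC 2015 [BhowmickLovett2015]. Def. 2.1 (p. 6): "A function `f : 𝔽_pⁿ → 𝕋` is a polynomial of
  degree at most `d` if `D_{h₁} … D_{h_{d+1}} f ≡ 0` for any `h₁, …, h_{d+1} ∈ 𝔽_pⁿ`."  Thm 1.1 /
  Thm 3.1–3.2 (pp. 3, 8–9): the Viola–Wigderson / Bourgain derivative argument gives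
  `|E_x e(f(x)) ω₃^{x₁+⋯+x_n}| ≤ 2^{−Ω(n/4^d)}` for every NONCLASSICAL polynomial of degree `d`, and
  "**Theorem 3.2.** Let `m ∈ ℕ` be odd and fix `a ∈ {1, …, m − 1}`. For any `ε > 0` there exists a
  polynomial `f : 𝔽₂ⁿ → 𝕋` of degree `log((n+m)/ε) + O(1)` such that
  `E_x e(f(x))·ω_m^{a(x₁+⋯+x_n)} = 1 + u` where `|u| ≤ ε`" — proof: `f(x) = A(|x₁|+⋯+|x_n|)/2^k
  (mod 1)`, "note that `f` is a polynomial of degree `≤ k`".  "So, the Viola–Wigderson technique is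
  bounded for degrees smaller than `O(log n)`, because it extends to nonclassical polynomials of that
  degree, for which it is tight. … the modulus 3 in Theorem 1.1 can be replaced with any fixed odd
  modulus." (p. 3).

**What this file adds (all PROVED; the one catalogue fact is discharged).**
`NonclassicalPolynomials.IsNonclassicalPoly d f` — Def. 2.1 for `p = 2`, for a real-valued lift `f`
of a map into `𝕋 = ℝ/ℤ` (all `(d+1)`-fold additive derivatives are `ℤ`-valued; depends only on
`f mod ℤ`: `IsNonclassicalPoly.add_intValued`; monotone: `IsNonclassicalPoly.succ`); the digit
functions `digitFn c a k = c + (Σ_i a_i[x_i = 1])/2^k` have degree `≤ k`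
(`isNonclassicalPoly_digitFn`, by `deriv_digitFn_succ`: a derivative drops the level), hence so does
`blPoly m a k = −⌊a2^k/m⌋·|x|/2^k` (`isNonclassicalPoly_blPoly`); the phase identity
`blPoly(x) + a|x|/m = |x|·(a2^k mod m)/(m2^k)` (`blPoly_add_eq`); **`bhowmickLovett_thm32`**:
`‖Σ_x e(blPoly x)·e(a|x|/m) − 2ⁿ‖ ≤ (2πn/2^k)·2ⁿ` for EVERY modulus `m ≥ 1` and residue `a`;
the printed `ε`-form **`exists_lowDegree_correlation_ge`**: degree `k = ⌈log₂⌈2πn/ε⌉⌉`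
(`= log₂(n/ε) + O(1)`) achieves `Re E_x e(f(x)) e(a|x|/m) ≥ 1 − ε`; the catalogue decl
`NonclassicalDegreeLogBarrier` with `nonclassicalDegreeLogBarrier_holds`.
§2–§3 (the METHOD half, [BhowmickLovett2015, Thm 3.1] = [ViolaWigderson2008, Lemma 2.3 & §2.3] run
for nonclassical phases): the degree norms in recursive form `uPow k F = U_{k+1}(F)`
(`avg`, `mulDeriv`, `uPow`; [ViolaWigderson2008, Def. 2.2]), the van der Corput identity
`avg_avg_mulDeriv` (`E_h E_y Δ_hG = |E G|²`), the Gowers–Cauchy–Schwarz lemma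
**`norm_avg_mul_eChar_pow_le`**: `|E F·e(P)|^{2^{d+1}} ≤ U_{d+1}(F)` for `‖F‖_∞ ≤ 1` and EVERY `P`
of nonclassical degree `≤ d`; the product rule `uPow_prodFn` ([ViolaWigderson2008, Fact 2.7]) with
the one-bit recursion `gowersOneBit` and its closed form `gowersOneBit_eChar`
(`γ_k(e(φ)) = 1 − (1 − cos(2π2^kφ))/2^{k+1}`); and **`bhowmickLovett_thm31`**: for `m` odd, `m ∤ a`,
`|Σ_x e(P(x))e(a|x|/m)|^{2^{d+1}} ≤ (1 − (1 − cos(2π/m))/2^{d+1})ⁿ(2ⁿ)^{2^{d+1}}`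
(`= 2^{−Ω(n/4^d)}` correlation) — restated on `Fin n` as `nonclassicalDegreeLogBarrier_upper`.

## References
* [BhowmickLovett2015] A. Bhowmick, S. Lovett, CCC 2015, LIPIcs 33, 72–87; arXiv:1412.4719 (held):
  Def. 2.1 (p. 6), Thm 1.1 (p. 3), Thm 3.1 (p. 8), Thm 3.2 (p. 9).
* [ServedioTan2022] R. Servedio, L.-Y. Tan, Theory of Computing 18(4) (2022), pp. 8–9 (held).
* [IvanovPavlovicViola2023] P. Ivanov, L. Pavlovic, E. Viola, *On correlation bounds against
  polynomials*, CCC 2023, arXiv:2311.09370, §1 (p. 3), §1.3.1 (p. 4) (held).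
* [ViolaWigderson2008] E. Viola, A. Wigderson, Theory of Computing 4 (2008) 137–168 (the `U^d`
  method for `MOD_m` vs degree-`d` polynomials).
-/

noncomputable section

namespace Literature.Barriers.QuantumAdvantage

namespace NonclassicalPolynomials

open Finset Complex

variable {ι : Type*}

/-! ### Nonclassical degree over `𝔽₂` (Bhowmick–Lovett Def. 2.1, `p = 2`), for real-valued lifts -/

/-- The additive (discrete) derivative in direction `h`: `D_h f (x) = f (x + h) − f x`.
[cite: BhowmickLovett2015, §2 (Def. 2.1)] -/
def deriv (h : ι → ZMod 2) (f : (ι → ZMod 2) → ℝ) : (ι → ZMod 2) → ℝ := fun x => f (x + h) - f x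

/-- Iterated derivative along a list of directions (the head is applied first).
[cite: BhowmickLovett2015, §2 (Def. 2.1)] -/
def iterDeriv : List (ι → ZMod 2) → ((ι → ZMod 2) → ℝ) → (ι → ZMod 2) → ℝ
  | [], f => f
  | h :: hs, f => iterDeriv hs (deriv h f)

/-- A real-valued function is `ℤ`-valued, i.e. its image in `𝕋 = ℝ/ℤ` vanishes (the "`≡ 0`" of
Def. 2.1 for real lifts). [cite: BhowmickLovett2015, Def. 2.1] -/
def IsIntValued (g : (ι → ZMod 2) → ℝ) : Prop := ∀ x, ∃ z : ℤ, g x = z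

/-- **Nonclassical polynomial of degree `≤ d`** [BhowmickLovett2015, Def. 2.1, `p = 2`]: a map
`F : 𝔽₂^ι → 𝕋 = ℝ/ℤ` is a (nonclassical) polynomial of degree at most `d` iff
`D_{h₁} ⋯ D_{h_{d+1}} F ≡ 0` for all directions.  We phrase it for a real-valued LIFT `f` of `F`
(`F = f mod ℤ`): every `(d+1)`-fold additive derivative of `f` is `ℤ`-valued.  The notion depends only
on `f mod ℤ` (`IsNonclassicalPoly.add_intValued`). [cite: BhowmickLovett2015, Def. 2.1] -/
def IsNonclassicalPoly (d : ℕ) (f : (ι → ZMod 2) → ℝ) : Prop :=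
  ∀ hs : List (ι → ZMod 2), hs.length = d + 1 → IsIntValued (iterDeriv hs f)

/-- No derivative. [cite: BhowmickLovett2015, Def. 2.1] -/
@[simp] theorem iterDeriv_nil (f : (ι → ZMod 2) → ℝ) : iterDeriv [] f = f := rfl

/-- One more derivative (applied first). [cite: BhowmickLovett2015, Def. 2.1] -/
@[simp] theorem iterDeriv_cons (h : ι → ZMod 2) (hs : List (ι → ZMod 2)) (f : (ι → ZMod 2) → ℝ) :
    iterDeriv (h :: hs) f = iterDeriv hs (deriv h f) := rfl

/-- `D_h` is additive. [cite: BhowmickLovett2015, §2 (D_h f)] -/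
theorem deriv_add (h : ι → ZMod 2) (f g : (ι → ZMod 2) → ℝ) :
    deriv h (f + g) = deriv h f + deriv h g := by
  funext x
  simp only [deriv, Pi.add_apply]
  ring

/-- Iterated derivatives are additive. [cite: BhowmickLovett2015, §2 (D_h f)] -/
theorem iterDeriv_add (hs : List (ι → ZMod 2)) :
    ∀ f g : (ι → ZMod 2) → ℝ, iterDeriv hs (f + g) = iterDeriv hs f + iterDeriv hs g := by
  induction hs with
  | nil => intro f g; rfl
  | cons h hs ih => intro f g; rw [iterDeriv_cons, iterDeriv_cons, iterDeriv_cons, deriv_add, ih]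

/-- Iterated derivative along a concatenation. [cite: BhowmickLovett2015, §2 (Def. 2.1)] -/
theorem iterDeriv_append (l₁ l₂ : List (ι → ZMod 2)) :
    ∀ f : (ι → ZMod 2) → ℝ, iterDeriv (l₁ ++ l₂) f = iterDeriv l₂ (iterDeriv l₁ f) := by
  induction l₁ with
  | nil => intro f; rfl
  | cons h t ih => intro f; rw [List.cons_append, iterDeriv_cons, iterDeriv_cons, ih]

/-- Sums of `ℤ`-valued functions are `ℤ`-valued. [cite: BhowmickLovett2015, Def. 2.1] -/
theorem IsIntValued.add {f g : (ι → ZMod 2) → ℝ} (hf : IsIntValued f) (hg : IsIntValued g) :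
    IsIntValued (f + g) := by
  intro x
  obtain ⟨a, ha⟩ := hf x
  obtain ⟨b, hb⟩ := hg x
  exact ⟨a + b, by rw [Pi.add_apply, ha, hb, Int.cast_add]⟩

/-- Derivatives of `ℤ`-valued functions are `ℤ`-valued. [cite: BhowmickLovett2015, Def. 2.1] -/
theorem IsIntValued.deriv {g : (ι → ZMod 2) → ℝ} (hg : IsIntValued g) (h : ι → ZMod 2) :
    IsIntValued (deriv h g) := by
  intro x
  obtain ⟨a, ha⟩ := hg (x + h)
  obtain ⟨b, hb⟩ := hg x
  exact ⟨a - b, by rw [NonclassicalPolynomials.deriv, ha, hb, Int.cast_sub]⟩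

/-- Iterated derivatives of `ℤ`-valued functions are `ℤ`-valued. [cite: BhowmickLovett2015, Def. 2.1] -/
theorem IsIntValued.iterDeriv {g : (ι → ZMod 2) → ℝ} (hg : IsIntValued g) :
    ∀ hs : List (ι → ZMod 2), IsIntValued (iterDeriv hs g) := by
  intro hs
  induction hs generalizing g with
  | nil => exact hg
  | cons h hs ih => exact ih (hg.deriv h)

/-- The degree notion only depends on `f mod ℤ`: adding a `ℤ`-valued function preserves it.
[cite: BhowmickLovett2015, Def. 2.1] -/
theorem IsNonclassicalPoly.add_intValued {d : ℕ} {f g : (ι → ZMod 2) → ℝ}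
    (hf : IsNonclassicalPoly d f) (hg : IsIntValued g) : IsNonclassicalPoly d (f + g) := by
  intro hs hlen
  rw [iterDeriv_add]
  exact (hf hs hlen).add (hg.iterDeriv hs)

/-- Degree `≤ d` implies degree `≤ d + 1`. [cite: BhowmickLovett2015, Def. 2.1] -/
theorem IsNonclassicalPoly.succ {d : ℕ} {f : (ι → ZMod 2) → ℝ} (hf : IsNonclassicalPoly d f) :
    IsNonclassicalPoly (d + 1) f := by
  intro hs hlen
  obtain ⟨l, b, rfl⟩ : ∃ l b, hs = l ++ [b] := by
    rcases List.eq_nil_or_concat hs with h | ⟨l, b, h⟩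
    · subst h; simp at hlen
    · exact ⟨l, b, by rw [h, List.concat_eq_append]⟩
  rw [List.length_append, List.length_singleton] at hlen
  rw [iterDeriv_append, iterDeriv_cons, iterDeriv_nil]
  exact (hf l (by omega)).deriv b

/-! ### The digit functions `c + (Σ_i a_i [x_i = 1]) / 2^k` have nonclassical degree `≤ k` -/

section Digit

variable [Fintype ι]

/-- The Hamming weight `|x| = #{i : x_i = 1}`. [cite: BhowmickLovett2015, §3 (|x₁| + ⋯ + |x_n|)] -/
def weight (x : ι → ZMod 2) : ℕ := (univ.filter fun i => x i = 1).card

/-- Digit functions `c + (Σ_i a_i·[x_i = 1]) / 2^k` with integer `a_i`.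
[cite: BhowmickLovett2015, §2 (Tao–Ziegler form of nonclassical polynomials) & Thm 3.2 (proof)] -/
def digitFn (c : ℝ) (a : ι → ℤ) (k : ℕ) (x : ι → ZMod 2) : ℝ :=
  c + (∑ i, (a i : ℝ) * (if x i = 1 then 1 else 0)) / 2 ^ k

/-- `𝔽₂ = {0, 1}`. [folklore] -/
private theorem zmod_two_cases (u : ZMod 2) : u = 0 ∨ u = 1 := by
  fin_cases u
  · exact Or.inl rfl
  · exact Or.inr rfl

/-- One-coordinate difference: `[x_i + h_i = 1] − [x_i = 1] = [h_i = 1]·(1 − 2[x_i = 1])` over `𝔽₂`.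
[folklore] -/
private theorem ind_add_sub (u v : ZMod 2) :
    ((if u + v = 1 then (1 : ℝ) else 0) - (if u = 1 then 1 else 0))
      = if v = 1 then 1 - 2 * (if u = 1 then (1 : ℝ) else 0) else 0 := by
  have h11 : (1 : ZMod 2) + 1 = 0 := by decide
  rcases zmod_two_cases u with rfl | rfl <;> rcases zmod_two_cases v with rfl | rfl
  · simp
  · simp
  · simp
  · simp [h11]
    norm_num

/-- `D_h` of a digit function at level `k + 1` is a digit function at level `k`:
`D_h (c + Σ a_i[x_i]/2^{k+1}) = (Σ_{h_i = 1} a_i)/2^{k+1} + Σ_i (−a_i[h_i = 1])·[x_i]/2^k`.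
[cite: BhowmickLovett2015, Thm 3.2 (proof: "f is a polynomial of degree ≤ k")] -/
theorem deriv_digitFn_succ (c : ℝ) (a : ι → ℤ) (k : ℕ) (h : ι → ZMod 2) :
    deriv h (digitFn c a (k + 1))
      = digitFn ((∑ i, if h i = 1 then (a i : ℝ) else 0) / 2 ^ (k + 1))
          (fun i => if h i = 1 then -a i else 0) k := by
  funext x
  have h2k : (2 : ℝ) ^ k ≠ 0 := pow_ne_zero _ two_ne_zero
  have key : ∀ i, (a i : ℝ) * ((if x i + h i = 1 then 1 else 0) - (if x i = 1 then 1 else 0))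
        / 2 ^ (k + 1)
      = (if h i = 1 then (a i : ℝ) else 0) / 2 ^ (k + 1) +
          (((if h i = 1 then -a i else 0 : ℤ) : ℝ) * (if x i = 1 then 1 else 0)) / 2 ^ k := by
    intro i
    rw [ind_add_sub]
    by_cases hh : h i = 1
    · simp only [hh, if_true, Int.cast_neg, pow_succ]
      field_simp
      ring
    · simp [hh]
  simp only [deriv, digitFn]
  rw [add_sub_add_left_eq_sub, ← sub_div, ← sum_sub_distrib]
  have hs : ∑ i, ((a i : ℝ) * (if (x + h) i = 1 then 1 else 0) - (a i : ℝ) * (if x i = 1 then 1 else 0))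
      = ∑ i, (a i : ℝ) * ((if x i + h i = 1 then 1 else 0) - (if x i = 1 then 1 else 0)) := by
    refine sum_congr rfl fun i _ => ?_
    rw [Pi.add_apply, mul_sub]
  rw [hs, sum_div, sum_congr rfl fun i _ => key i, sum_add_distrib, ← sum_div, ← sum_div]

/-- `D_h` of a level-`0` digit function (an integer combination plus a constant) is `ℤ`-valued.
[cite: BhowmickLovett2015, Thm 3.2 (proof)] -/
theorem isIntValued_deriv_digitFn_zero (c : ℝ) (a : ι → ℤ) (h : ι → ZMod 2) :
    IsIntValued (deriv h (digitFn c a 0)) := by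
  intro x
  refine ⟨∑ i, if h i = 1 then a i * (1 - 2 * (if x i = 1 then 1 else 0)) else 0, ?_⟩
  simp only [deriv, digitFn, pow_zero, div_one, add_sub_add_left_eq_sub]
  rw [← sum_sub_distrib, Int.cast_sum]
  refine sum_congr rfl fun i _ => ?_
  rw [Pi.add_apply, ← mul_sub, ind_add_sub]
  push_cast
  simp only [mul_ite, mul_zero]

/-- **Digit functions at level `k` have nonclassical degree `≤ k`** (induction on `k`: each derivative
drops the level by one).  [cite: BhowmickLovett2015, Thm 3.2 (proof: "note that f is a polynomial of degree ≤ k"; Tao–Ziegler)] -/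
theorem isNonclassicalPoly_digitFn : ∀ (k : ℕ) (c : ℝ) (a : ι → ℤ), IsNonclassicalPoly k (digitFn c a k)
  | 0, c, a => by
      intro hs hlen
      match hs, hlen with
      | [h], _ => simpa using isIntValued_deriv_digitFn_zero c a h
  | k + 1, c, a => by
      intro hs hlen
      match hs, hlen with
      | h :: hs', hlen' =>
          rw [iterDeriv_cons, deriv_digitFn_succ]
          exact isNonclassicalPoly_digitFn k _ _ hs' (by simpa using hlen')

/-- The weight is the sum of the coordinate indicators. [folklore] -/
private theorem weight_eq_sum (x : ι → ZMod 2) : (weight x : ℝ) = ∑ i, (if x i = 1 then (1 : ℝ) else 0) := by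
  rw [weight, sum_boole]

/-- **`x ↦ A·|x|/2^k` has nonclassical degree `≤ k`** for every integer `A`.
[cite: BhowmickLovett2015, Thm 3.2 (proof)] -/
theorem isNonclassicalPoly_intMul_weight_div (A : ℤ) (k : ℕ) :
    IsNonclassicalPoly k (fun x : ι → ZMod 2 => (A : ℝ) * weight x / 2 ^ k) := by
  have h : (fun x : ι → ZMod 2 => (A : ℝ) * weight x / 2 ^ k) = digitFn 0 (fun _ => A) k := by
    funext x
    simp only [digitFn, zero_add, weight_eq_sum, mul_sum]
  simpa only [h] using isNonclassicalPoly_digitFn k 0 (fun _ => A)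

end Digit


/-! ### Bhowmick–Lovett Thm 3.2: a degree-`k` nonclassical polynomial correlating with the `MOD_m` character -/

section Barrier

variable [Fintype ι] [DecidableEq ι]

/-- The character `e(t) = exp(2πit)` of `𝕋 = ℝ/ℤ`, on real lifts. [cite: BhowmickLovett2015, §1 (e : 𝕋 → ℂ*)] -/
def eChar (t : ℝ) : ℂ := Complex.exp (2 * Real.pi * I * t)

/-- `e` is additive-to-multiplicative. [cite: BhowmickLovett2015, §1 (e(x) = exp(2πix))] -/
theorem eChar_add (s t : ℝ) : eChar (s + t) = eChar s * eChar t := by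
  rw [eChar, eChar, eChar, ← Complex.exp_add]
  push_cast
  ring_nf

/-- `e` factors through `𝕋 = ℝ/ℤ`: `e(z) = 1` for `z ∈ ℤ`. [cite: BhowmickLovett2015, §1 (e : 𝕋 → ℂ*)] -/
theorem eChar_intCast (z : ℤ) : eChar (z : ℝ) = 1 := by
  rw [eChar]
  have h : (2 * Real.pi * I * ((z : ℝ) : ℂ)) = z * (2 * Real.pi * I) := by push_cast; ring
  rw [h, Complex.exp_int_mul_two_pi_mul_I]

/-- `|e(t)| = 1`. [cite: BhowmickLovett2015, §1 (e : 𝕋 → ℂ*)] -/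
theorem norm_eChar (t : ℝ) : ‖eChar t‖ = 1 := by
  rw [eChar]
  have h : (2 * Real.pi * I * (t : ℂ)) = ((2 * Real.pi * t : ℝ) : ℂ) * I := by push_cast; ring
  rw [h, Complex.norm_exp_ofReal_mul_I]

/-- `|e(t) − 1| ≤ 2π|t|` (the rounding step `e(−aq/m + θ_x)`, `θ_x` small, of the source).
[cite: BhowmickLovett2015, Thm 3.2 (proof)] -/
theorem norm_eChar_sub_one_le (t : ℝ) : ‖eChar t - 1‖ ≤ 2 * Real.pi * |t| := by
  rw [eChar]
  have h : (2 * Real.pi * I * (t : ℂ)) = I * ((2 * Real.pi * t : ℝ) : ℂ) := by push_cast; ring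
  rw [h]
  refine (Real.norm_exp_I_mul_ofReal_sub_one_le (x := 2 * Real.pi * t)).trans (le_of_eq ?_)
  rw [Real.norm_eq_abs, abs_mul, abs_of_pos Real.two_pi_pos]

/-- **The Bhowmick–Lovett polynomial** `f(x) = −⌊a·2^k/m⌋ · |x| / 2^k` (their `A(|x₁|+⋯+|x_n|)/2^k`,
`A = (r − a2^k)/m`, `r ≡ a2^k (mod m)`). [cite: BhowmickLovett2015, Thm 3.2 (proof)] -/
def blPoly (m a k : ℕ) (x : ι → ZMod 2) : ℝ := -((a * 2 ^ k / m : ℕ) : ℝ) * weight x / 2 ^ k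

omit [DecidableEq ι] in
/-- The Bhowmick–Lovett polynomial has nonclassical degree `≤ k`.
[cite: BhowmickLovett2015, Thm 3.2 (proof: "f is a polynomial of degree ≤ k")] -/
theorem isNonclassicalPoly_blPoly (m a k : ℕ) :
    IsNonclassicalPoly k (blPoly m a k : (ι → ZMod 2) → ℝ) := by
  have h := isNonclassicalPoly_intMul_weight_div (ι := ι) (-((a * 2 ^ k / m : ℕ) : ℤ)) k
  have e : (blPoly m a k : (ι → ZMod 2) → ℝ)
      = fun x : ι → ZMod 2 => ((-((a * 2 ^ k / m : ℕ) : ℤ) : ℤ) : ℝ) * weight x / 2 ^ k := by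
    funext x
    simp only [blPoly, Int.cast_neg, Int.cast_natCast]
  rw [e]
  exact h

omit [DecidableEq ι] in
/-- The phase identity: `f(x) + a|x|/m = |x|·r/(m·2^k)` with `r = a2^k mod m ∈ [0, m)`.
[cite: BhowmickLovett2015, Thm 3.2 (proof: f(x) ≡ −aq/m + θ_x)] -/
theorem blPoly_add_eq (m : ℕ) [NeZero m] (a k : ℕ) (x : ι → ZMod 2) :
    blPoly m a k x + a * weight x / m = weight x * ((a * 2 ^ k % m : ℕ) : ℝ) / (m * 2 ^ k) := by
  have hdm : (m : ℝ) * ((a * 2 ^ k / m : ℕ) : ℝ) + ((a * 2 ^ k % m : ℕ) : ℝ) = (a : ℝ) * 2 ^ k := by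
    exact_mod_cast Nat.div_add_mod (a * 2 ^ k) m
  have hm : (m : ℝ) ≠ 0 := by exact_mod_cast NeZero.ne m
  have h2 : (2 : ℝ) ^ k ≠ 0 := pow_ne_zero _ two_ne_zero
  rw [blPoly, div_add_div _ _ h2 hm, div_eq_div_iff (mul_ne_zero h2 hm) (mul_ne_zero hm h2)]
  have hr : ((a * 2 ^ k % m : ℕ) : ℝ) = (a : ℝ) * 2 ^ k - (m : ℝ) * ((a * 2 ^ k / m : ℕ) : ℝ) := by
    linarith
  rw [hr]
  ring

/-- The number of points of the cube `𝔽₂^ι`. [folklore] -/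
private theorem card_cube : (Fintype.card (ι → ZMod 2) : ℝ) = 2 ^ Fintype.card ι := by
  classical
  rw [Fintype.card_fun, ZMod.card]
  push_cast
  rfl

/-- **Bhowmick–Lovett, Theorem 3.2 (explicit form, every modulus `m ≥ 1` and residue `a`)**: the
degree-`≤ k` nonclassical polynomial `f = blPoly m a k` satisfies
`‖Σ_{x ∈ 𝔽₂^ι} e(f(x))·e(a|x|/m) − 2^{|ι|}‖ ≤ (2π|ι|/2^k)·2^{|ι|}`, i.e.
`E_x e(f(x)) ω_m^{a|x|} = 1 + u` with `|u| ≤ 2π n/2^k`.  So the `U^{k+1}`/derivative method, which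
bounds this correlation by `2^{−Ω(n/4^k)}` for every nonclassical degree-`k` phase, proves nothing at
`k ≥ log₂ n + O(1)`.  [cite: BhowmickLovett2015, Thm 3.2] -/
theorem bhowmickLovett_thm32 (m : ℕ) [NeZero m] (a k : ℕ) :
    IsNonclassicalPoly k (blPoly m a k : (ι → ZMod 2) → ℝ) ∧
      ‖∑ x : ι → ZMod 2, eChar (blPoly m a k x) * eChar (a * weight x / m)
          - (2 : ℂ) ^ Fintype.card ι‖
        ≤ 2 * Real.pi * Fintype.card ι / 2 ^ k * 2 ^ Fintype.card ι := by
  classical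
  refine ⟨isNonclassicalPoly_blPoly m a k, ?_⟩
  have h2 : (0 : ℝ) < (2 : ℝ) ^ k := pow_pos two_pos k
  have hmpos : (0 : ℝ) < (m : ℝ) := by exact_mod_cast NeZero.pos m
  have hpt : ∀ x : ι → ZMod 2,
      ‖eChar (blPoly m a k x) * eChar (a * weight x / m) - 1‖ ≤ 2 * Real.pi * Fintype.card ι / 2 ^ k := by
    intro x
    rw [← eChar_add, blPoly_add_eq]
    refine (norm_eChar_sub_one_le _).trans ?_
    have hw : (weight x : ℝ) ≤ Fintype.card ι := by
      exact_mod_cast (card_le_univ (univ.filter fun i => x i = 1))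
    have hr : ((a * 2 ^ k % m : ℕ) : ℝ) ≤ m := by
      exact_mod_cast (Nat.mod_lt _ (NeZero.pos m)).le
    have hnn : 0 ≤ (weight x : ℝ) * ((a * 2 ^ k % m : ℕ) : ℝ) / (m * 2 ^ k) := by positivity
    rw [abs_of_nonneg hnn]
    have key : (weight x : ℝ) * ((a * 2 ^ k % m : ℕ) : ℝ) / (m * 2 ^ k)
        ≤ (Fintype.card ι : ℝ) / 2 ^ k := by
      rw [div_le_div_iff₀ (mul_pos hmpos h2) h2]
      calc (weight x : ℝ) * ((a * 2 ^ k % m : ℕ) : ℝ) * 2 ^ k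
          ≤ (Fintype.card ι : ℝ) * m * 2 ^ k := by gcongr
        _ = Fintype.card ι * (m * 2 ^ k) := by ring
    calc 2 * Real.pi * ((weight x : ℝ) * ((a * 2 ^ k % m : ℕ) : ℝ) / (m * 2 ^ k))
        ≤ 2 * Real.pi * ((Fintype.card ι : ℝ) / 2 ^ k) :=
          mul_le_mul_of_nonneg_left key (by positivity)
      _ = 2 * Real.pi * Fintype.card ι / 2 ^ k := by ring
  have hsum : ∑ x : ι → ZMod 2, eChar (blPoly m a k x) * eChar (a * weight x / m) - (2 : ℂ) ^ Fintype.card ι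
      = ∑ x : ι → ZMod 2, (eChar (blPoly m a k x) * eChar (a * weight x / m) - 1) := by
    rw [sum_sub_distrib, sum_const, card_univ, nsmul_eq_mul, mul_one]
    congr 1
    exact_mod_cast card_cube.symm
  rw [hsum]
  calc ‖∑ x : ι → ZMod 2, (eChar (blPoly m a k x) * eChar (a * weight x / m) - 1)‖
      ≤ ∑ x : ι → ZMod 2, ‖eChar (blPoly m a k x) * eChar (a * weight x / m) - 1‖ := norm_sum_le _ _
    _ ≤ ∑ _x : ι → ZMod 2, 2 * Real.pi * Fintype.card ι / 2 ^ k := sum_le_sum fun x _ => hpt x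
    _ = 2 * Real.pi * Fintype.card ι / 2 ^ k * 2 ^ Fintype.card ι := by
        rw [sum_const, card_univ, nsmul_eq_mul, card_cube, mul_comm]

/-- **The printed `ε`-form of Theorem 3.2**: for every modulus `m ≥ 1`, residue `a` and `ε > 0`, the
nonclassical polynomial `blPoly m a k` of degree `≤ k := ⌈log₂⌈2πn/ε⌉⌉ = log₂(n/ε) + O(1)` has
`Re E_x e(f(x))·e(a|x|/m) ≥ 1 − ε` ("degree `log((n+m)/ε) + O(1)`", correlation `1 + u`, `|u| ≤ ε`).
[cite: BhowmickLovett2015, Thm 3.2] -/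
theorem exists_lowDegree_correlation_ge (m : ℕ) [NeZero m] (a : ℕ) {ε : ℝ} (hε : 0 < ε) :
    ∃ (k : ℕ) (f : (ι → ZMod 2) → ℝ),
      k = Nat.clog 2 ⌈2 * Real.pi * Fintype.card ι / ε⌉₊ ∧ IsNonclassicalPoly k f ∧
        (1 - ε) * 2 ^ Fintype.card ι
          ≤ (∑ x : ι → ZMod 2, eChar (f x) * eChar (a * weight x / m)).re := by
  set k := Nat.clog 2 ⌈2 * Real.pi * Fintype.card ι / ε⌉₊ with hk
  obtain ⟨hdeg, hnorm⟩ := bhowmickLovett_thm32 (ι := ι) m a k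
  refine ⟨k, blPoly m a k, rfl, hdeg, ?_⟩
  have h2 : (0 : ℝ) < (2 : ℝ) ^ k := pow_pos two_pos k
  -- `2π n / 2^k ≤ ε`
  have hkε : 2 * Real.pi * Fintype.card ι / 2 ^ k ≤ ε := by
    have h1 : 2 * Real.pi * Fintype.card ι / ε ≤ (⌈2 * Real.pi * Fintype.card ι / ε⌉₊ : ℝ) :=
      Nat.le_ceil _
    have h3 : (⌈2 * Real.pi * Fintype.card ι / ε⌉₊ : ℝ) ≤ (2 : ℝ) ^ k := by
      exact_mod_cast Nat.le_pow_clog one_lt_two _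
    rw [div_le_iff₀ h2]
    have h4 := (div_le_iff₀ hε).1 (h1.trans h3)
    linarith
  set S := ∑ x : ι → ZMod 2, eChar (blPoly m a k x) * eChar (a * weight x / m) with hS
  have hre : (2 : ℝ) ^ Fintype.card ι - ‖S - (2 : ℂ) ^ Fintype.card ι‖ ≤ S.re := by
    have h := Complex.abs_re_le_norm (S - (2 : ℂ) ^ Fintype.card ι)
    have h2c : ((2 : ℂ) ^ Fintype.card ι) = (((2 : ℝ) ^ Fintype.card ι : ℝ) : ℂ) := by push_cast; rfl
    have h' : (S - (2 : ℂ) ^ Fintype.card ι).re = S.re - 2 ^ Fintype.card ι := by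
      rw [Complex.sub_re, h2c, Complex.ofReal_re]
    rw [h'] at h
    have := neg_le_of_abs_le h
    linarith
  have hpow : (0 : ℝ) ≤ (2 : ℝ) ^ Fintype.card ι := by positivity
  calc (1 - ε) * 2 ^ Fintype.card ι
      = 2 ^ Fintype.card ι - ε * 2 ^ Fintype.card ι := by ring
    _ ≤ 2 ^ Fintype.card ι - 2 * Real.pi * Fintype.card ι / 2 ^ k * 2 ^ Fintype.card ι := by
        gcongr
    _ ≤ 2 ^ Fintype.card ι - ‖S - (2 : ℂ) ^ Fintype.card ι‖ := by linarith
    _ ≤ S.re := hre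

end Barrier

/-! ### §2. The degree norm (Viola–Wigderson Def. 2.2) on the cube and the other half of BL15 Thm 1.1 -/

section Derivatives

variable {ι : Type*}

/-- `𝔽₂ = {0, 1}`. [folklore] -/
private theorem zmod_two_cases' (u : ZMod 2) : u = 0 ∨ u = 1 := by
  fin_cases u
  · exact Or.inl rfl
  · exact Or.inr rfl

/-- Multiplicative derivative `Δ_h F (x) = F(x + h) · conj F(x)`.
[cite: BhowmickLovett2015, §2 (Gowers uniformity norms: Δ_h F)] -/
def mulDeriv (h : ι → ZMod 2) (F : (ι → ZMod 2) → ℂ) : (ι → ZMod 2) → ℂ :=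
  fun x => F (x + h) * (starRingEnd ℂ) (F x)

/-- `conj e(t) = e(−t)`. [cite: BhowmickLovett2015, §1 (e : 𝕋 → ℂ*)] -/
theorem conj_eChar (t : ℝ) : (starRingEnd ℂ) (eChar t) = eChar (-t) := by
  rw [eChar, eChar, ← Complex.exp_conj]
  congr 1
  simp only [map_mul, map_ofNat, Complex.conj_ofReal, Complex.conj_I, Complex.ofReal_neg]
  ring

/-- `Δ_h (F · e(P)) = Δ_h F · e(D_h P)`. [cite: BhowmickLovett2015, §2 ("if F = e(f) then Δ_h F = e(D_h f)")] -/
theorem mulDeriv_mul_eChar (h : ι → ZMod 2) (F : (ι → ZMod 2) → ℂ) (P : (ι → ZMod 2) → ℝ) :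
    mulDeriv h (fun x => F x * eChar (P x)) = fun x => mulDeriv h F x * eChar (deriv h P x) := by
  funext x
  simp only [mulDeriv, deriv, map_mul, conj_eChar]
  rw [sub_eq_add_neg, eChar_add]
  ring

/-- A derivative lowers the nonclassical degree. [cite: BhowmickLovett2015, Def. 2.1] -/
theorem IsNonclassicalPoly.deriv {d : ℕ} {P : (ι → ZMod 2) → ℝ} (hP : IsNonclassicalPoly (d + 1) P)
    (h : ι → ZMod 2) : IsNonclassicalPoly d (NonclassicalPolynomials.deriv h P) := by
  intro hs hlen
  have e : iterDeriv hs (NonclassicalPolynomials.deriv h P) = iterDeriv (h :: hs) P := rfl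
  rw [e]
  exact hP (h :: hs) (by simp [hlen])

/-- Degree `≤ 0` means the phase `e(P)` is constant. [cite: BhowmickLovett2015, Def. 2.1] -/
theorem eChar_eq_of_isNonclassicalPoly_zero {P : (ι → ZMod 2) → ℝ} (hP : IsNonclassicalPoly 0 P)
    (x : ι → ZMod 2) : eChar (P x) = eChar (P 0) := by
  obtain ⟨z, hz⟩ := hP [x] rfl 0
  have e : P x = P 0 + z := by
    have h1 : iterDeriv [x] P 0 = P (0 + x) - P 0 := rfl
    rw [h1, zero_add] at hz
    linarith
  rw [e, eChar_add, eChar_intCast, mul_one]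

/-- `Δ_h` of a `1`-bounded function is `1`-bounded. [folklore] -/
private theorem norm_mulDeriv_le {F : (ι → ZMod 2) → ℂ} (hF : ∀ x, ‖F x‖ ≤ 1) (h x : ι → ZMod 2) :
    ‖mulDeriv h F x‖ ≤ 1 := by
  rw [mulDeriv, norm_mul, RCLike.norm_conj]
  calc ‖F (x + h)‖ * ‖F x‖ ≤ 1 * 1 := mul_le_mul (hF _) (hF _) (norm_nonneg _) zero_le_one
    _ = 1 := mul_one 1

end Derivatives

section DegreeNorm

variable {ι : Type*} [Fintype ι] [DecidableEq ι]


/-- Average over the cube `𝔽₂^ι`. [cite: ViolaWigderson2008, §2 (E_x)] -/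
def avg (G : (ι → ZMod 2) → ℂ) : ℂ := (∑ x, G x) / (Fintype.card (ι → ZMod 2) : ℂ)

/-- Average of a real function over the cube. [cite: ViolaWigderson2008, §2 (E_x)] -/
def avgR (G : (ι → ZMod 2) → ℝ) : ℝ := (∑ x, G x) / (Fintype.card (ι → ZMod 2) : ℝ)

/-- **The degree norms in recursive form**: `uPow 0 F = |E F|² = U_1(F)` and
`uPow (k+1) F = E_h uPow k (Δ_h F)`, so `uPow k F = U_{k+1}(F) = ‖F‖_{U^{k+1}}^{2^{k+1}}`
([ViolaWigderson2008, Def. 2.2]; [BhowmickLovett2015, §2]). [cite: ViolaWigderson2008, Def. 2.2] -/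
def uPow : ℕ → ((ι → ZMod 2) → ℂ) → ℝ
  | 0, F => ‖avg F‖ ^ 2
  | k + 1, F => avgR fun h => uPow k (mulDeriv h F)

/-- The cube is nonempty. [folklore] -/
private theorem card_cube_pos' : (0 : ℝ) < (Fintype.card (ι → ZMod 2) : ℝ) := by
  classical
  exact_mod_cast Fintype.card_pos

/-- `uPow` is non-negative. [cite: ViolaWigderson2008, Def. 2.2 ("always a non-negative real number")] -/
theorem uPow_nonneg : ∀ (k : ℕ) (F : (ι → ZMod 2) → ℂ), 0 ≤ uPow k F
  | 0, F => by simp only [uPow]; positivity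
  | k + 1, F => by
      simp only [uPow, avgR]
      exact div_nonneg (sum_nonneg fun h _ => uPow_nonneg k _) card_cube_pos'.le

/-- `avgR` is monotone. [folklore] -/
private theorem avgR_mono {G₁ G₂ : (ι → ZMod 2) → ℝ} (h : ∀ x, G₁ x ≤ G₂ x) : avgR G₁ ≤ avgR G₂ :=
  div_le_div_of_nonneg_right (sum_le_sum fun x _ => h x) card_cube_pos'.le

/-- Triangle inequality for the average. [folklore] -/
private theorem norm_avg_le (G : (ι → ZMod 2) → ℂ) : ‖avg G‖ ≤ avgR fun x => ‖G x‖ := by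
  rw [avg, avgR, norm_div, Complex.norm_natCast]
  exact div_le_div_of_nonneg_right (norm_sum_le _ _) card_cube_pos'.le

/-- Jensen for `t ↦ t^q` on an average. [folklore] -/
private theorem avgR_pow_le (G : (ι → ZMod 2) → ℝ) (hG : ∀ x, 0 ≤ G x) (q : ℕ) :
    (avgR G) ^ q ≤ avgR fun x => G x ^ q := by
  have hN : (0 : ℝ) < (Fintype.card (ι → ZMod 2) : ℝ) := card_cube_pos'
  have h := Real.pow_arith_mean_le_arith_mean_pow univ
    (fun _ => (Fintype.card (ι → ZMod 2) : ℝ)⁻¹) G (fun _ _ => by positivity)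
    (by rw [sum_const, card_univ, nsmul_eq_mul, mul_inv_cancel₀ hN.ne']) (fun x _ => hG x) q
  have e1 : avgR G = ∑ x, (Fintype.card (ι → ZMod 2) : ℝ)⁻¹ * G x := by
    rw [avgR, ← mul_sum, div_eq_inv_mul]
  have e2 : (avgR fun x => G x ^ q) = ∑ x, (Fintype.card (ι → ZMod 2) : ℝ)⁻¹ * G x ^ q := by
    rw [avgR, ← mul_sum, div_eq_inv_mul]
  rw [e1, e2]
  exact h

/-- **`E_h E_y Δ_h G(y) = |E G|²`** (the van der Corput / first Gowers–Cauchy–Schwarz identity).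
[cite: ViolaWigderson2008, Def. 2.2 & proof of Lemma 2.4] -/
theorem avg_avg_mulDeriv (G : (ι → ZMod 2) → ℂ) :
    (avg fun h => avg (mulDeriv h G)) = ((‖avg G‖ ^ 2 : ℝ) : ℂ) := by
  have hinner : ∀ y : ι → ZMod 2, ∑ h, G (y + h) = ∑ x, G x := fun y =>
    Fintype.sum_equiv (Equiv.addLeft y) _ _ fun h => rfl
  have hswap : ∑ h : ι → ZMod 2, ∑ y, G (y + h) * (starRingEnd ℂ) (G y)
      = ∑ y : ι → ZMod 2, (starRingEnd ℂ) (G y) * ∑ h, G (y + h) := by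
    rw [sum_comm]
    refine sum_congr rfl fun y _ => ?_
    rw [mul_sum]
    exact sum_congr rfl fun h _ => mul_comm _ _
  simp only [avg, mulDeriv]
  rw [← sum_div, hswap, sum_congr rfl fun y _ => by rw [hinner y], ← sum_mul]
  rw [← Complex.normSq_eq_norm_sq, Complex.normSq_eq_conj_mul_self, map_div₀, Complex.conj_natCast,
    map_sum, div_mul_div_comm, div_div]

/-- **The degree norm controls every nonclassical phase of lower degree** (Gowers–Cauchy–Schwarz /
[ViolaWigderson2008, Lemma 2.3], in the form used by [BhowmickLovett2015, Thm 3.1]: the argument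
"is based on derivatives, and hence extends to nonclassical polynomials"): for `‖F‖_∞ ≤ 1` and `P`
of nonclassical degree `≤ d`, `|E_x F(x) e(P(x))|^{2^{d+1}} ≤ U_{d+1}(F) = uPow d F`.
[cite: ViolaWigderson2008, Lemma 2.3; BhowmickLovett2015, Thm 3.1 (proof)] -/
theorem norm_avg_mul_eChar_pow_le : ∀ (d : ℕ) (F : (ι → ZMod 2) → ℂ) (P : (ι → ZMod 2) → ℝ),
    (∀ x, ‖F x‖ ≤ 1) → IsNonclassicalPoly d P →
      ‖avg fun x => F x * eChar (P x)‖ ^ 2 ^ (d + 1) ≤ uPow d F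
  | 0, F, P, hF, hP => by
      have e : (avg fun x => F x * eChar (P x)) = avg F * eChar (P 0) := by
        simp only [avg]
        rw [sum_congr rfl fun x _ => by rw [eChar_eq_of_isNonclassicalPoly_zero hP x], ← sum_mul]
        ring
      rw [e, norm_mul, norm_eChar, mul_one]
      simp [uPow]
  | d + 1, F, P, hF, hP => by
      -- |E G|² = E_h A_h, A_h = E_y Δ_h F(y) e(D_h P(y))
      set G : (ι → ZMod 2) → ℂ := fun x => F x * eChar (P x) with hG
      have hA : ∀ h, ‖avg (mulDeriv h G)‖ ^ 2 ^ (d + 1) ≤ uPow d (mulDeriv h F) := by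
        intro h
        rw [hG, mulDeriv_mul_eChar]
        exact norm_avg_mul_eChar_pow_le d (mulDeriv h F) (deriv h P) (norm_mulDeriv_le hF h)
          (hP.deriv h)
      have hsq : ‖avg G‖ ^ 2 = ‖avg fun h => avg (mulDeriv h G)‖ := by
        rw [avg_avg_mulDeriv, Complex.norm_real, Real.norm_eq_abs, abs_of_nonneg (by positivity)]
      calc ‖avg G‖ ^ 2 ^ (d + 1 + 1) = (‖avg G‖ ^ 2) ^ 2 ^ (d + 1) := by
            rw [← pow_mul]; congr 1; ring
        _ = ‖avg fun h => avg (mulDeriv h G)‖ ^ 2 ^ (d + 1) := by rw [hsq]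
        _ ≤ (avgR fun h => ‖avg (mulDeriv h G)‖) ^ 2 ^ (d + 1) :=
            pow_le_pow_left₀ (norm_nonneg _) (norm_avg_le _) _
        _ ≤ avgR fun h => ‖avg (mulDeriv h G)‖ ^ 2 ^ (d + 1) :=
            avgR_pow_le _ (fun h => norm_nonneg _) _
        _ ≤ avgR fun h => uPow d (mulDeriv h F) := avgR_mono hA
        _ = uPow (d + 1) F := rfl


/-! ### §3. The `MOD_m` character has small degree norm (Viola–Wigderson §2.3 / BL15 Thm 3.1) -/

/-- Product functions `x ↦ Π_{i ∈ S} φ_θ(x_i)`, `φ_θ(0) = 1`, `φ_θ(1) = θ` (so `θ^{|x|}` for `S = univ`).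
[cite: ViolaWigderson2008, §2.3 (e_m^a as a product of 1-bit functions, Fact 2.7)] -/
def prodFn (θ : ℂ) (S : Finset ι) (x : ι → ZMod 2) : ℂ := ∏ i ∈ S, (if x i = 1 then θ else 1)

/-- Sum over the cube of a product over `S` of one-bit functions.
[cite: ViolaWigderson2008, Fact 2.7 (norm of a product of functions on disjoint bits)] -/
theorem sum_prod_oneBit {R : Type*} [CommSemiring R] (g : ZMod 2 → R) (S : Finset ι) :
    ∑ x : ι → ZMod 2, ∏ i ∈ S, g (x i) = (g 0 + g 1) ^ S.card * 2 ^ (Fintype.card ι - S.card) := by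
  have h1 : ∀ x : ι → ZMod 2, ∏ i ∈ S, g (x i) = ∏ i, (if i ∈ S then g (x i) else 1) := by
    intro x
    rw [prod_ite_mem, univ_inter]
  simp_rw [h1]
  rw [← Fintype.prod_sum (fun i u => if i ∈ S then g u else (1 : R))]
  have h2 : ∀ i, (∑ u : ZMod 2, if i ∈ S then g u else (1 : R)) = if i ∈ S then g 0 + g 1 else 2 := by
    intro i
    split_ifs
    · exact Fin.sum_univ_two _
    · simp
  simp_rw [h2]
  rw [prod_ite, prod_const, prod_const]
  congr 2
  · simp
  · rw [filter_not, card_sdiff_of_subset (filter_subset _ _), card_univ]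
    simp

/-- The cube has `2^{|ι|}` points (complex form). [folklore] -/
private theorem card_cube_complex : (Fintype.card (ι → ZMod 2) : ℂ) = 2 ^ Fintype.card ι := by
  rw [Fintype.card_fun, ZMod.card]
  push_cast
  rfl

/-- The cube has `2^{|ι|}` points (real form). [folklore] -/
private theorem card_cube_real : (Fintype.card (ι → ZMod 2) : ℝ) = 2 ^ Fintype.card ι := by
  rw [Fintype.card_fun, ZMod.card]
  push_cast
  rfl

/-- Average of a product of one-bit functions (complex). [cite: ViolaWigderson2008, Fact 2.7] -/
theorem avg_prod_oneBit (g : ZMod 2 → ℂ) (S : Finset ι) :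
    (avg fun x : ι → ZMod 2 => ∏ i ∈ S, g (x i)) = ((g 0 + g 1) / 2) ^ S.card := by
  have hS : S.card ≤ Fintype.card ι := card_le_univ S
  obtain ⟨t, ht⟩ := Nat.exists_eq_add_of_le hS
  rw [avg, sum_prod_oneBit, card_cube_complex, div_pow, ht, Nat.add_sub_cancel_left, pow_add]
  have h2 : (2 : ℂ) ^ t ≠ 0 := pow_ne_zero _ two_ne_zero
  have h2' : (2 : ℂ) ^ S.card ≠ 0 := pow_ne_zero _ two_ne_zero
  field_simp

/-- Average of a product of one-bit functions (real). [cite: ViolaWigderson2008, Fact 2.7] -/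
theorem avgR_prod_oneBit (g : ZMod 2 → ℝ) (S : Finset ι) :
    (avgR fun x : ι → ZMod 2 => ∏ i ∈ S, g (x i)) = ((g 0 + g 1) / 2) ^ S.card := by
  have hS : S.card ≤ Fintype.card ι := card_le_univ S
  obtain ⟨t, ht⟩ := Nat.exists_eq_add_of_le hS
  rw [avgR, sum_prod_oneBit, card_cube_real, div_pow, ht, Nat.add_sub_cancel_left, pow_add]
  have h2 : (2 : ℝ) ^ t ≠ 0 := pow_ne_zero _ two_ne_zero
  have h2' : (2 : ℝ) ^ S.card ≠ 0 := pow_ne_zero _ two_ne_zero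
  field_simp

/-- A unimodular constant does not change the degree norm. [cite: ViolaWigderson2008, Def. 2.2] -/
theorem uPow_const_mul {c : ℂ} (hc : ‖c‖ = 1) :
    ∀ (k : ℕ) (G : (ι → ZMod 2) → ℂ), uPow k (fun x => c * G x) = uPow k G
  | 0, G => by
      simp only [uPow, avg]
      rw [← mul_sum, mul_div_assoc, norm_mul, hc, one_mul]
  | k + 1, G => by
      have e : ∀ h, mulDeriv h (fun x => c * G x) = mulDeriv h G := by
        intro h
        funext x
        simp only [mulDeriv, map_mul]
        have hcc : c * (starRingEnd ℂ) c = 1 := by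
          rw [Complex.mul_conj, Complex.normSq_eq_norm_sq, hc]; norm_num
        linear_combination (G (x + h) * (starRingEnd ℂ) (G x)) * hcc
      simp only [uPow, e]

omit [Fintype ι] [DecidableEq ι] in
/-- `Δ_h` of a product function: `Δ_h Π_{i∈S} φ_θ(x_i) = θ^{|S ∩ h|} · Π_{i ∈ S, h_i = 1} φ_{θ̄²}(x_i)`
for unimodular `θ`. [cite: ViolaWigderson2008, §2.3 (computation of U_k(e_m^a))] -/
theorem mulDeriv_prodFn {θ : ℂ} (hθ : ‖θ‖ = 1) (S : Finset ι) (h : ι → ZMod 2) :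
    mulDeriv h (prodFn θ S)
      = fun x => θ ^ (S.filter fun i => h i = 1).card *
          prodFn ((starRingEnd ℂ) θ ^ 2) (S.filter fun i => h i = 1) x := by
  funext x
  have hcc : θ * (starRingEnd ℂ) θ = 1 := by
    rw [Complex.mul_conj, Complex.normSq_eq_norm_sq, hθ]; norm_num
  have h11 : (1 : ZMod 2) + 1 = 0 := by decide
  simp only [mulDeriv, prodFn, Pi.add_apply, map_prod]
  rw [← prod_mul_distrib, prod_filter, ← prod_const, prod_filter, ← prod_mul_distrib]
  refine prod_congr rfl fun i _ => ?_
  rcases zmod_two_cases' (h i) with hh | hh <;> rcases zmod_two_cases' (x i) with hx | hx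
  · simp [hh, hx]
  · simp only [hh, hx, add_zero, if_true, mul_one, zero_ne_one, if_false]
    linear_combination hcc
  · simp [hh, hx]
  · simp only [hh, hx, h11, zero_ne_one, if_false, if_true, one_mul]
    linear_combination (-(starRingEnd ℂ) θ) * hcc

/-- The one-bit recursion `γ_0(θ) = |1+θ|²/4`, `γ_{k+1}(θ) = (1 + γ_k(θ̄²))/2` for the degree norms of
`φ_θ`. [cite: ViolaWigderson2008, §2.3 (U_k(e_m^a))] -/
def gowersOneBit : ℕ → ℂ → ℝ
  | 0, θ => ‖(1 + θ) / 2‖ ^ 2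
  | k + 1, θ => (1 + gowersOneBit k ((starRingEnd ℂ) θ ^ 2)) / 2

/-- **The degree norm of a product function multiplies over the bits** ([ViolaWigderson2008, Fact 2.7])
and equals `γ_k(θ)^{|S|}`. [cite: ViolaWigderson2008, Fact 2.7 & §2.3] -/
theorem uPow_prodFn : ∀ (k : ℕ) {θ : ℂ}, ‖θ‖ = 1 → ∀ S : Finset ι,
    uPow k (prodFn θ S) = gowersOneBit k θ ^ S.card
  | 0, θ, _, S => by
      have e : prodFn θ S = fun x : ι → ZMod 2 => ∏ i ∈ S, (if x i = 1 then θ else (1 : ℂ)) := rfl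
      simp only [uPow, gowersOneBit]
      rw [e, avg_prod_oneBit (fun u : ZMod 2 => if u = 1 then θ else (1 : ℂ)) S]
      simp [norm_pow, ← pow_mul, mul_comm]
  | k + 1, θ, hθ, S => by
      have hθ' : ‖(starRingEnd ℂ) θ ^ 2‖ = 1 := by rw [norm_pow, RCLike.norm_conj, hθ, one_pow]
      have hθk : ∀ h : ι → ZMod 2, ‖θ ^ (S.filter fun i => h i = 1).card‖ = 1 := fun h => by
        rw [norm_pow, hθ, one_pow]
      simp only [uPow]
      have e : ∀ h : ι → ZMod 2, uPow k (mulDeriv h (prodFn θ S))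
          = ∏ i ∈ S, (if h i = 1 then gowersOneBit k ((starRingEnd ℂ) θ ^ 2) else (1 : ℝ)) := by
        intro h
        rw [mulDeriv_prodFn hθ, uPow_const_mul (hθk h), uPow_prodFn k hθ', ← prod_const, prod_filter]
      simp_rw [e]
      rw [avgR_prod_oneBit (fun u : ZMod 2 => if u = 1 then gowersOneBit k ((starRingEnd ℂ) θ ^ 2) else (1 : ℝ)) S]
      simp [gowersOneBit]

/-- `e(n·t) = e(t)^n`. [cite: BhowmickLovett2015, §1 (e : 𝕋 → ℂ*)] -/
theorem eChar_nat_mul (n : ℕ) (t : ℝ) : eChar (n * t) = eChar t ^ n := by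
  induction n with
  | zero => simp [eChar]
  | succ n ih => rw [Nat.cast_succ, add_mul, one_mul, eChar_add, ih, pow_succ]

omit [DecidableEq ι] in
/-- The `MOD_m` character is a product of one-bit functions: `e(a|x|/m) = Π_i φ_θ(x_i)`,
`θ = e(a/m)`. [cite: ViolaWigderson2008, §2.3 (e_m^a(Σ x_i) = Π_i e_m^a(x_i))] -/
theorem eChar_weight_eq_prodFn (a m : ℕ) (x : ι → ZMod 2) :
    eChar (a * weight x / m) = prodFn (eChar ((a : ℝ) / m)) univ x := by
  rw [prodFn, prod_ite, prod_const_one, mul_one, prod_const, ← eChar_nat_mul, weight]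
  congr 1
  ring

/-- Closed form of the one-bit recursion at a character value:
`γ_k(e(φ)) = 1 − (1 − cos(2π·2^k φ))/2^{k+1}`. [cite: ViolaWigderson2008, §2.3 (U_k(e_m^a) ≤ 1 − Ω(1/2^k)); BhowmickLovett2015, Thm 3.1 (proof: (1 − 2^{−d}) + 2^{−d}cos(2πa′/m))] -/
theorem gowersOneBit_eChar : ∀ (k : ℕ) (φ : ℝ),
    gowersOneBit k (eChar φ) = 1 - (1 - Real.cos (2 * Real.pi * 2 ^ k * φ)) / 2 ^ (k + 1)
  | 0, φ => by
      simp only [gowersOneBit, pow_zero, mul_one, zero_add, pow_one]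
      have e1 : (1 + eChar φ) / 2
          = (((1 + Real.cos (2 * Real.pi * φ)) / 2 : ℝ) : ℂ)
            + ((Real.sin (2 * Real.pi * φ) / 2 : ℝ) : ℂ) * I := by
        have h : (2 * Real.pi * I * (φ : ℂ)) = ((2 * Real.pi * φ : ℝ) : ℂ) * I := by push_cast; ring
        rw [eChar, h, Complex.exp_mul_I, ← Complex.ofReal_cos, ← Complex.ofReal_sin]
        push_cast
        ring
      rw [e1, ← Complex.normSq_eq_norm_sq, Complex.normSq_add_mul_I]
      nlinarith [Real.sin_sq_add_cos_sq (2 * Real.pi * φ)]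
  | k + 1, φ => by
      simp only [gowersOneBit]
      have e1 : (starRingEnd ℂ) (eChar φ) ^ 2 = eChar (-2 * φ) := by
        rw [conj_eChar, sq, ← eChar_add]
        congr 1
        ring
      rw [e1, gowersOneBit_eChar k (-2 * φ)]
      have e2 : Real.cos (2 * Real.pi * 2 ^ k * (-2 * φ)) = Real.cos (2 * Real.pi * 2 ^ (k + 1) * φ) := by
        rw [← Real.cos_neg]
        congr 1
        ring
      rw [e2, pow_succ (2 : ℝ) (k + 1)]
      field_simp
      ring

/-- `cos(2πj/m) ≤ cos(2π/m)` when `m ∤ j`. [folklore] -/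
private theorem cos_two_pi_mul_div_le {m j : ℕ} (hm : 0 < m) (hj : ¬ m ∣ j) :
    Real.cos (2 * Real.pi * j / m) ≤ Real.cos (2 * Real.pi / m) := by
  have hmR : (0 : ℝ) < m := by exact_mod_cast hm
  set r := j % m with hr
  have hr0 : r ≠ 0 := fun h => hj (Nat.dvd_of_mod_eq_zero h)
  have hrm : r < m := Nat.mod_lt _ hm
  have hdm : (m : ℝ) * ((j / m : ℕ) : ℝ) + (r : ℝ) = j := by exact_mod_cast Nat.div_add_mod j m
  have e1 : Real.cos (2 * Real.pi * j / m) = Real.cos (2 * Real.pi * r / m) := by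
    have h : 2 * Real.pi * (j : ℝ) / m = 2 * Real.pi * r / m + ((j / m : ℕ) : ℝ) * (2 * Real.pi) := by
      rw [← hdm]
      field_simp
      ring
    rw [h, Real.cos_add_nat_mul_two_pi]
  rw [e1]
  rcases Nat.lt_or_ge m (2 * r) with h2 | h2
  swap
  · refine Real.cos_le_cos_of_nonneg_of_le_pi (by positivity) ?_ ?_
    · rw [div_le_iff₀ hmR]
      have : (2 * r : ℝ) ≤ m := by exact_mod_cast h2
      nlinarith [Real.pi_pos]
    · have : (1 : ℝ) ≤ r := by exact_mod_cast Nat.one_le_iff_ne_zero.2 hr0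
      rw [div_le_div_iff_of_pos_right hmR]
      nlinarith [Real.pi_pos]
  · have e2 : Real.cos (2 * Real.pi * r / m) = Real.cos (2 * Real.pi * ((m - r : ℕ) : ℝ) / m) := by
      rw [← Real.cos_two_pi_sub]
      congr 1
      rw [Nat.cast_sub hrm.le]
      field_simp
    rw [e2]
    refine Real.cos_le_cos_of_nonneg_of_le_pi (by positivity) ?_ ?_
    · rw [div_le_iff₀ hmR, Nat.cast_sub hrm.le]
      have : (m : ℝ) < 2 * r := by exact_mod_cast h2
      nlinarith [Real.pi_pos]
    · have : (1 : ℝ) ≤ ((m - r : ℕ) : ℝ) := by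
        have : 1 ≤ m - r := by omega
        exact_mod_cast this
      rw [div_le_div_iff_of_pos_right hmR]
      nlinarith [Real.pi_pos]

omit [Fintype ι] [DecidableEq ι] in
/-- Product functions with a unimodular parameter are `1`-bounded. [folklore] -/
private theorem norm_prodFn_le {θ : ℂ} (hθ : ‖θ‖ = 1) (S : Finset ι) (x : ι → ZMod 2) :
    ‖prodFn θ S x‖ ≤ 1 := by
  rw [prodFn, norm_prod]
  refine prod_le_one (fun i _ => norm_nonneg _) fun i _ => ?_
  split_ifs
  · exact hθ.le
  · simp

/-- **Bhowmick–Lovett, Theorem 3.1 (= Viola–Wigderson §2.3 for NONCLASSICAL phases; the upper-bound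
half of BL15 Thm 1.1).**  For `m` odd, `m ∤ a` and every real lift `P` of a nonclassical polynomial of
degree `≤ d` on `𝔽₂^ι` (`|ι| = n`):
`|Σ_x e(P(x))·e(a|x|/m)|^{2^{d+1}} ≤ (1 − (1 − cos(2π/m))/2^{d+1})ⁿ · (2ⁿ)^{2^{d+1}}`, i.e.
`|E_x e(P(x)) ω_m^{a|x|}| ≤ (1 − Ω_m(2^{−d}))^{n/2^{d+1}} = 2^{−Ω(n/4^d)}` — the derivative method's
bound, which `bhowmickLovett_thm32` shows to be useless at `d ≥ log₂ n + O(1)`.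
[cite: BhowmickLovett2015, Thm 3.1; ViolaWigderson2008, Lemma 2.3 & §2.3] -/
theorem bhowmickLovett_thm31 {m : ℕ} (hm : Odd m) {a : ℕ} (ha : ¬ m ∣ a) (d : ℕ)
    {P : (ι → ZMod 2) → ℝ} (hP : IsNonclassicalPoly d P) :
    ‖∑ x : ι → ZMod 2, eChar (P x) * eChar (a * weight x / m)‖ ^ 2 ^ (d + 1)
      ≤ (1 - (1 - Real.cos (2 * Real.pi / m)) / 2 ^ (d + 1)) ^ Fintype.card ι
          * ((2 : ℝ) ^ Fintype.card ι) ^ 2 ^ (d + 1) := by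
  have hm0 : 0 < m := hm.pos
  set θ : ℂ := eChar ((a : ℝ) / m) with hθdef
  have hθ : ‖θ‖ = 1 := norm_eChar _
  -- Gowers–Cauchy–Schwarz + the product computation
  have key := norm_avg_mul_eChar_pow_le d (prodFn θ univ) P (norm_prodFn_le hθ univ) hP
  rw [uPow_prodFn d hθ univ, card_univ] at key
  -- the one-bit norm is at most `ρ`
  have hcos : Real.cos (2 * Real.pi * 2 ^ d * ((a : ℝ) / m)) ≤ Real.cos (2 * Real.pi / m) := by
    have hnd : ¬ m ∣ 2 ^ d * a := fun h =>
      ha ((Nat.Coprime.pow_right d hm.coprime_two_right).dvd_of_dvd_mul_left h)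
    have h := cos_two_pi_mul_div_le hm0 hnd
    have e : 2 * Real.pi * 2 ^ d * ((a : ℝ) / m) = 2 * Real.pi * ((2 ^ d * a : ℕ) : ℝ) / m := by
      push_cast
      ring
    rwa [e]
  have h2d : (2 : ℝ) ≤ 2 ^ (d + 1) := by
    calc (2 : ℝ) = 2 ^ 1 := (pow_one _).symm
      _ ≤ 2 ^ (d + 1) := pow_le_pow_right₀ one_le_two (by omega)
  have hg0 : 0 ≤ gowersOneBit d θ := by
    rw [hθdef, gowersOneBit_eChar]
    have hc : -1 ≤ Real.cos (2 * Real.pi * 2 ^ d * ((a : ℝ) / m)) := Real.neg_one_le_cos _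
    rw [sub_nonneg, div_le_one (by positivity)]
    linarith
  have hg : gowersOneBit d θ ≤ 1 - (1 - Real.cos (2 * Real.pi / m)) / 2 ^ (d + 1) := by
    rw [hθdef, gowersOneBit_eChar]
    have h2 : (0 : ℝ) < 2 ^ (d + 1) := by positivity
    rw [sub_le_sub_iff_left, div_le_div_iff_of_pos_right h2]
    linarith
  -- the sum is `2^n · avg`
  have hsum : ∑ x : ι → ZMod 2, eChar (P x) * eChar (a * weight x / m)
      = (2 : ℂ) ^ Fintype.card ι * avg (fun x => prodFn θ univ x * eChar (P x)) := by
    rw [avg, card_cube_complex, mul_div_cancel₀ _ (pow_ne_zero _ two_ne_zero)]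
    refine sum_congr rfl fun x _ => ?_
    rw [eChar_weight_eq_prodFn, mul_comm]
  rw [hsum, norm_mul, norm_pow, Complex.norm_two, mul_pow, mul_comm]
  exact mul_le_mul_of_nonneg_right (key.trans (pow_le_pow_left₀ hg0 hg _)) (by positivity)

end DegreeNorm

end NonclassicalPolynomials

open NonclassicalPolynomials in
/-- **Nonclassical polynomials of degree `log₂ n + O(1)` have correlation `1 − o(1)` with every
`MOD_m` character** (the catalogue decl: Bhowmick–Lovett's Theorem 3.2 in the explicit form of
`bhowmickLovett_thm32`; PROVED below, `nonclassicalDegreeLogBarrier_holds`).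

BARRIER
technique_class: correlation bounds for low-degree polynomials against `MOD_m` / modular characters on the Boolean cube that are proved through ITERATED ADDITIVE DERIVATIVES / the `U^{d+1}` Gowers norm / repeated Cauchy–Schwarz "degree reduction" — Babai–Nisan–Szegedy 1992, Bourgain 2005, Green–Roy–Straubing 2005, Viola–Wigderson 2008, Chattopadhyay–Wigderson 2009 (in the tree: `Literature/Computability/MetaComplexity/TwoModuliExpSums`, `LowDegreeTwoModuliExpSums` (GRS05 Thm 1.1, bound `(2μ_d)ⁿ` with `1 − μ_d ≥ (1−μ₁)/(q2^q)^{d−1}`), and every rung of the advice-free-`QNC⁰` ladder that feeds them: `R12`/`Q*`-static, `R-lin`, regularise–expand); such an argument uses of the degree-`d` phase `P` only that `D_{h₁}⋯D_{h_{d+1}} P ≡ 0`, hence applies verbatim to NONCLASSICAL polynomials `f : 𝔽₂ⁿ → 𝕋` of degree `d` (`NonclassicalPolynomials.IsNonclassicalPoly`; carried out in this file: `norm_avg_mul_eChar_pow_le`, `bhowmickLovett_thm31`) [cite: BhowmickLovett2015, Thm 1.1 and Thm 3.1 (p. 3, p. 8)] [cite: ViolaWigderson2008, Lemma 2.3 &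 §2.3]
blocks: pushing method family (a) of the `AdviceFreeQNC0` ceiling notes — "superpolynomially small correlation of `MOD_m` / the walk functional against `𝔽_p`-polynomials of degree `≫ log n`" — by derivative/Gowers-norm arguments: for every modulus `m ≥ 1`, residue `a` and `k` there is a nonclassical polynomial of degree `≤ k` with `‖Σ_x e(f(x))e(a|x|/m) − 2ⁿ‖ ≤ (2πn/2^k)·2ⁿ` (`bhowmickLovett_thm32`), so at degree `k = log₂(2πn/ε)` the method's conclusion is false for an object it cannot distinguish from a classical polynomial; the folklore statement it explains: "Degree log(n) represents the fundamental limit of our current suite of powerful techniques for proving `F₂` correlation bounds … breaking this 'degree-log(n) barrier' would constitute a significant technical breakthrough" [cite: ServedioTan2022, p. 8] and no explicit function is known to have correlation below `1/√n` with all degree-`log n` polynomials [cite: IvanovPavlovicViola2023, §1 (p. 3)]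
because: `f(x) = −⌊a2^k/m⌋·|x|/2^k (mod 1)` is a nonclassical polynomial of degree `≤ k` (each additive derivative lowers the dyadic level of a digit function `c + Σ a_i[x_i]/2^k` by one — `deriv_digitFn_succ`, `isNonclassicalPoly_digitFn`; Tao–Ziegler's classification in the source) and `f(x) + a|x|/m = |x|·(a2^k mod m)/(m2^k) ∈ [0, n/2^k]` (`blPoly_add_eq`), so every term of `E_x e(f(x))ω_m^{a|x|}` is within `2πn/2^k` of `1` [cite: BhowmickLovett2015, Thm 3.2 (proof, p. 9)]
evasions_known: methods that use CLASSICAL-only structure of polynomials: the Razborov–Smolensky dimension/rank argument gives `O(d/√n)`-type correlation for degree up to `√n` but never below `1/√n` [cite: IvanovPavlovicViola2023, §1 (p. 3)]; the "maximal-correlation polynomials are symmetric / exact structure" programme of Ivanov–Pavlovic–Viola, who "argue that non-classical polynomials do not constitute an obstacle for [their] approach" [cite: IvanovPavlovicViola2023, §1.3.1 (p. 4)]; structured subclasses (sparse, set-multilinear, small-read polynomials) where degree `≫ log n` IS handled [cite: ServedioTan2022, p. 8–9]; none published achieves correlation `< 1/√n` against all degree-`log n` polynomials [cite: IvanovPavlovicViola2023,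 §1 (p. 3)]
scope_caveats: proved here are BOTH halves of Thm 1.1 for the `MOD_m` CHARACTER `e(a|x|/m)` on `𝔽₂ⁿ`: the existence half (Thm 3.2, `bhowmickLovett_thm32`, every `m ≥ 1` and `a` — the paper states `m` odd, `a ∈ {1,…,m−1}`; for `m ∣ a` or `m` even, `a = m/2` it is trivially consistent) and the method half (Thm 3.1, `bhowmickLovett_thm31`, `m` odd, `m ∤ a`, with the explicit base `1 − (1 − cos(2π/m))/2^{d+1}` in place of the printed `2^{−Ω(n/4^d)}`); the MAJORITY (Thm 1.2/4.1), exact-computation (Thm 1.3) and weak-OR-representation (Thm 1.5) versions, correlation under the paper's non-uniform distribution `Q` / with the Boolean `Mod_m` function (a finite Fourier combination of the characters), and input alphabets `𝔽_p`, `p ≠ 2`, are NOT vendored; the entry says nothing about methods outside the technique class (rank/dimension arguments, structure of maximisers, algorithmic method), nothing about BOOLEAN-valued degree-`log n` polynomials (a nonclassical phase is not a Boolean function — the barrier is about what the METHOD can certify, not about whether degree-`log n` classical polynomials actually correlate with `MOD_m`), and nothing about relational/average-case game statements except through the exponential-sum lemmas they call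
status: established — Theorems 3.1 and 3.2 are PROVED in the tree (`NonclassicalPolynomials.bhowmickLovett_thm31`, `bhowmickLovett_thm32`, `exists_lowDegree_correlation_ge`, `nonclassicalDegreeLogBarrier_holds`, `nonclassicalDegreeLogBarrier_upper`) [cite: BhowmickLovett2015, Thm 3.1 & Thm 3.2] -/
def NonclassicalDegreeLogBarrier : Prop :=
  ∀ (n m a k : ℕ), 0 < m →
    NonclassicalPolynomials.IsNonclassicalPoly k
        (NonclassicalPolynomials.blPoly m a k : (Fin n → ZMod 2) → ℝ) ∧
      ‖∑ x : Fin n → ZMod 2, eChar (NonclassicalPolynomials.blPoly m a k x) * eChar (a * weight x / m)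
          - (2 : ℂ) ^ n‖ ≤ 2 * Real.pi * n / 2 ^ k * 2 ^ n

open NonclassicalPolynomials in
/-- **Discharge**: the barrier is a theorem. [cite: BhowmickLovett2015, Thm 3.2] -/
theorem nonclassicalDegreeLogBarrier_holds : NonclassicalDegreeLogBarrier := by
  intro n m a k hm
  haveI : NeZero m := ⟨hm.ne'⟩
  have h := bhowmickLovett_thm32 (ι := Fin n) m a k
  simp only [Fintype.card_fin] at h
  exact h

/-- `NonclassicalDegreeLogBarrier` — `_holds` alias of `nonclassicalDegreeLogBarrier_holds` above under the fact's exact name (appended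
2026-08-28, D-0026 bookkeeping: the proof term is the existing theorem of this file; no statement,
definition or attribute is edited; no new named fact; the ledger's debt table listed the fact
unproved). [cite: BhowmickLovett2015, Thm 3.2] -/
theorem _root_.Literature.Barriers.QuantumAdvantage.NonclassicalDegreeLogBarrier_holds :
    NonclassicalDegreeLogBarrier :=
  _root_.Literature.Barriers.QuantumAdvantage.nonclassicalDegreeLogBarrier_holds


open NonclassicalPolynomials in
/-- **The method half on `Fin n`** (Bhowmick–Lovett Thm 3.1 / Viola–Wigderson): for `m` odd, `m ∤ a`,
every real lift `P` of a nonclassical polynomial of degree `≤ d` on `𝔽₂ⁿ` has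
`|Σ_x e(P(x))e(a|x|/m)|^{2^{d+1}} ≤ (1 − (1 − cos(2π/m))/2^{d+1})ⁿ·(2ⁿ)^{2^{d+1}}`.
[cite: BhowmickLovett2015, Thm 3.1; ViolaWigderson2008, Lemma 2.3 & §2.3] -/
theorem nonclassicalDegreeLogBarrier_upper {m : ℕ} (hm : Odd m) {a : ℕ} (ha : ¬ m ∣ a) (n d : ℕ)
    {P : (Fin n → ZMod 2) → ℝ} (hP : NonclassicalPolynomials.IsNonclassicalPoly d P) :
    ‖∑ x : Fin n → ZMod 2, eChar (P x) * eChar (a * weight x / m)‖ ^ 2 ^ (d + 1)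
      ≤ (1 - (1 - Real.cos (2 * Real.pi / m)) / 2 ^ (d + 1)) ^ n * ((2 : ℝ) ^ n) ^ 2 ^ (d + 1) := by
  have h := bhowmickLovett_thm31 (ι := Fin n) hm ha d hP
  simp only [Fintype.card_fin] at h
  exact h

end Literature.Barriers.QuantumAdvantage
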